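import Summits.BirchSwinnertonDyer.Rank1Residual.X2.GreenbergVatsalTateDatum
import Summits.BirchSwinnertonDyer.Rank1Residual.X2.GreenbergVatsalTorsionCurve
import Summits.BirchSwinnertonDyer.Rank1Residual.X2.GreenbergVatsalSelmerEquality
import Summits.BirchSwinnertonDyer.Rank1Residual.X2.GreenbergVatsalStrictAtPQuotient
import HarnessLib

/-!
# The unramified quotient `D = E[p^∞]/C` of the Tate datum at `p ‖ N` is `ℚ_p/ℤ_p(φ)`: every
# `σ ∈ Γ_{K_v}` acts on `D` by the SIGN `φ(σ) = σ(t)/t`, `t = √γ(E)`; at a NON-split place a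
# Frobenius flipping `t` makes `Frob − 1 = −2` SURJECTIVE on `D` (odd `p`), at a split place `D_v`
# acts trivially

HONEST FRAMING (cell `b2b-bsdres`, run/shared/lean/b2b/bsd-rank1-residual/, verbatim in every
file): the goal of the cell is to DELETE the COMBINATION-SHAPED residual classes of the
Birch–Swinnerton-Dyer formula for ALL analytic-rank `≤ 1` elliptic curves over `ℚ` — "full BSD
formula for every rank `≤ 1` curve in class `C`" assembled STRICTLY from published theorems — so
that the rank-`≤ 1` remainder becomes exactly the CONSTRUCTION-SHAPED classes, which are TYPED
(missing-input `Prop`s), NOT attempted. This is not "finishing BSD". Sub-cell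
`b2b-bsdres-eisenstein-p2` (CLASS-OWNERS row "X2"), gen 12: research route; NO CLAIM BEYOND STATED
CLASSES; nothing here changes a label. THEOREMS ONLY (no `def`, no named fact, nothing asserted).

WHY (X2-GAP §16.6 (P5), the `p ‖ N` analogue of gen 10's `GreenbergVatsalStrictAtPQuotient` §3).
Greenberg–Vatsal, Invent. Math. 142 (2000) = arXiv:math/9906215, §2 pp. 14–15: at a prime `p ‖ N`
the `G_{ℚ_p}`-module `A = E[p^∞]` has the Tate-curve filtration `0 → C → A → D → 0` with
`C ≅ μ_{p^∞}(φ)`, `D ≅ ℚ_p/ℤ_p(φ)`, `φ` the unramified character of order `1` (split) or `2`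
(non-split): "If `E` has nonsplit multiplicative reduction at `p`, then the arguments described in
the introduction go through almost unchanged. However, if `E` has split multiplicative at `p` …
`Sel_E(ℚ_∞)_p` coincides with the 'strict' Selmer group … But `S_{E[p^∞]}(ℚ_∞)` is actually bigger.
This corresponds to the fact that the associated `p`-adic L-function has a trivial zero." THIS FILE
proves, for the Tate datum `C = ι⁻¹Ψ(μ)` (gen 9 `GreenbergVatsalTateDatum.tateDatum`) of a
parametrisation `Ψ : K̄_v^* → E(K̄_v)` (surjective, kernel `q^ℤ`, `q ∈ K_v`) with the TWISTED
equivariance `σ•Ψ(u) = χ(σ)Ψ(σu)`, `χ(σ) = [σt = t] − [σt ≠ t]` (Silverman *ATAEC* V.5.2 (c)/5.3/5.4,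
the shape of the tree's named fact `Silverman1994_thmV53_corV54_tateUniformisation`):
* §1 (any `LocalDatum` of `E[p^∞]`): continuity of the `D_v`-orbits on `D = E[p^∞]/M⁺`,
  `p`-divisibility, `p`-primarity, halving for odd `p`;
* §2 **`smul_sub_sign_smul_mem`**: `res σ • m − χ(σ)•m ∈ C` for EVERY `σ ∈ Γ_{K_v}`, `m ∈ E[p^∞]`
  (`ι m = Ψ(u)`, `u^{p^k} = q^a`, so `σu/u` is a root of unity and
  `σ•ι m ∓ ι m = ±Ψ(σu/u)^{±1}`) — i.e. **`D_v` acts on `D` through the sign `χ`**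
  (`smul_grMk_eq_sign_smul`, `smul_gr_eq_of_apply_eq`, `smul_gr_eq_neg_of_apply_ne`): GV's
  "`D ≅ ℚ_p/ℤ_p(φ)`";
* §3 **`exists_smul_sub_eq_of_apply_ne`**: if `σt ≠ t` then `res σ − 1 = −2` is SURJECTIVE on `D`
  for odd `p` (the input `hsurj` of `GreenbergVatsalStrictCore.exists_eq_smul_sub_of_vanishing_on_inertia_of_surjective`
  — non-split case, `e_p = 0`);
* §4 the untwisted (split) case `σ•Φ(u) = Φ(σu)`: `D_v` acts TRIVIALLY on `D` (`smul_gr_eq_of_equivariant`)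
  — so `H¹(G_𝔭/I_𝔭, D) = D ≅ ℚ_p/ℤ_p ≠ 0`: the trivial zero, `e_p = 1`.

References: Greenberg–Vatsal 2000 §2 pp. 14–15; Greenberg, LNM 1716 (1999) §2 pp. 75–76;
Silverman, *ATAEC* V.3.1, V.5.2–5.4; Serre, *Local Fields* XIII §1.
-/

noncomputable section

open scoped Classical AddSubgroup NNReal

open NumberField IsDedekindDomain Field
open Literature.NumberTheory.EllipticCurves Literature.NumberTheory.EllipticCurves.GreenbergSelmer
  Literature.NumberTheory.GaloisRepresentations IsDedekindDomain.HeightOneSpectrum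
  Summit.BirchSwinnertonDyer.Rank1Residual.X2.GreenbergVatsalTorsion
  Summit.BirchSwinnertonDyer.Rank1Residual.X2.GreenbergVatsalTateDatum
  Summit.BirchSwinnertonDyer.Rank1Residual.X2.GreenbergVatsalStrictAtPQuotient

universe u

namespace Summit.BirchSwinnertonDyer.Rank1Residual.X2.GreenbergVatsalTateDatumSign

variable {K : Type u} [Field K] [NumberField K] (W : WeierstrassCurve K) (p : ℕ)
  {v : HeightOneSpectrum (𝓞 K)}

/-! ## §1. Generic: the quotient `D = E[p^∞]/M⁺_v` of any local datum -/

section Generic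

variable (N : LocalDatum K (W.geomPrimaryTorsion p) v)

/-- Continuity of the `D_v`-orbit maps on `D = E[p^∞]/M⁺_v` (discrete) for ANY local datum.
[folklore] -/
theorem continuous_smul_gr (d : N.Gr) : Continuous fun g : decomp (K := K) v ↦ g • d := by
  obtain ⟨m, rfl⟩ := N.grMk_surjective d
  have e : (fun g : decomp (K := K) v ↦ g • N.grMk m) =
      fun g : decomp (K := K) v ↦ N.grMk (((g : decomp (K := K) v) : absoluteGaloisGroup K) • m) :=
    funext fun g ↦ LocalDatum.smul_grMk _ g m
  rw [e]
  exact continuous_of_discreteTopology.comp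
    ((W.continuous_smul_geomPrimaryTorsion p m).comp continuous_subtype_val)

/-- `D = E[p^∞]/M⁺_v` is `p`-primary. [cite: SilvermanAEC2009, Prop. III.4.2(a)] -/
theorem primary_gr (d : N.Gr) : ∃ k : ℕ, p ^ k • d = 0 := by
  obtain ⟨m, rfl⟩ := N.grMk_surjective d
  obtain ⟨k, hk⟩ := (AddCommGroup.mem_primaryComponent).1 m.2
  refine ⟨k, ?_⟩
  rw [← map_nsmul]
  have : p ^ k • m = 0 :=
    Subtype.ext (by rw [AddSubmonoidClass.coe_nsmul, ZeroMemClass.coe_zero]; exact hk)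
  rw [this, map_zero]

variable [W.IsElliptic] [hp : Fact p.Prime]

/-- `D = E[p^∞]/M⁺_v` is `p`-divisible (`E[p^∞]` is). [cite: SilvermanAEC2009, Prop. III.4.2(a)] -/
theorem divisible_gr (d : N.Gr) : ∃ d' : N.Gr, p • d' = d := by
  obtain ⟨m, rfl⟩ := N.grMk_surjective d
  obtain ⟨m', hm'⟩ := GreenbergVatsalTorsionCurve.divisible_curve W p m
  exact ⟨N.grMk m', by rw [← map_nsmul, hm']⟩

omit [W.IsElliptic] in
/-- **Halving in `D` for odd `p`**: every `d` is `2 • d'` (`d' = (p^k+1)/2 • d`). [folklore] -/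
theorem exists_two_nsmul_eq (hp2 : p ≠ 2) (d : N.Gr) : ∃ d' : N.Gr, 2 • d' = d := by
  obtain ⟨k, hk⟩ := primary_gr W p N d
  exact ⟨((p ^ k + 1) / 2) • d, GreenbergVatsalSelmerEquality.two_nsmul_half_eq (p := p) hp2 hp.out hk⟩

end Generic

/-! ## §2. The Tate datum: `D_v` acts on `D = E[p^∞]/C` through the sign `χ(σ) = σ(t)/t` -/

section Sign

variable [hp : Fact p.Prime]
  (Ψ : Additive (AlgebraicClosure (v.adicCompletion K))ˣ →+ localPoints W (v.adicCompletion K))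
  (t : AlgebraicClosure (v.adicCompletion K))
  (hΨσ : ∀ (σ : absoluteGaloisGroup (v.adicCompletion K))
      (u : (AlgebraicClosure (v.adicCompletion K))ˣ),
    σ • Ψ (Additive.ofMul u) =
      (if Field.absoluteGaloisGroup.toAlgEquiv (v.adicCompletion K) σ t = t then (1 : ℤ)
        else -1) •
      Ψ (Additive.ofMul (Units.map
        (Field.absoluteGaloisGroup.toAlgEquiv (v.adicCompletion K) σ :
          AlgebraicClosure (v.adicCompletion K) →* AlgebraicClosure (v.adicCompletion K)) u)))
  (hsurj : Function.Surjective Ψ) {q : v.adicCompletion K}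
  (hker : ∀ u : (AlgebraicClosure (v.adicCompletion K))ˣ, Ψ (Additive.ofMul u) = 0 →
    ∃ a : ℤ, (u : AlgebraicClosure (v.adicCompletion K)) =
      algebraMap (v.adicCompletion K) (AlgebraicClosure (v.adicCompletion K)) q ^ a)

include hΨσ in
/-- The twisted equivariance `σ•Ψ(u) = χ(σ)Ψ(σu)` is an instance of the "equivariant up to sign"
hypothesis `hΦ` of `GreenbergVatsalTateDatum.tateDatum`. [cite: SilvermanATAEC1994, Ch. V Lemma 5.2 (c), Thm. 5.3, Cor. 5.4] -/
theorem sign_disj : ∀ (σ : absoluteGaloisGroup (v.adicCompletion K))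
      (u : (AlgebraicClosure (v.adicCompletion K))ˣ),
      σ • Ψ (Additive.ofMul u) = Ψ (Additive.ofMul (Units.map
        (Field.absoluteGaloisGroup.toAlgEquiv (v.adicCompletion K) σ :
          AlgebraicClosure (v.adicCompletion K) →* AlgebraicClosure (v.adicCompletion K)) u)) ∨
      σ • Ψ (Additive.ofMul u) = -Ψ (Additive.ofMul (Units.map
        (Field.absoluteGaloisGroup.toAlgEquiv (v.adicCompletion K) σ :
          AlgebraicClosure (v.adicCompletion K) →* AlgebraicClosure (v.adicCompletion K)) u)) := by
  intro σ u
  rw [hΨσ σ u]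
  split_ifs
  · exact Or.inl (one_zsmul _)
  · exact Or.inr (neg_one_zsmul _)

include hsurj hker in
/-- **`D_v` acts on `D = E[p^∞]/C` through the sign `χ`**: for EVERY `σ ∈ Γ_{K_v}` and
`m ∈ E[p^∞]`, `res σ • m − χ(σ)•m ∈ C`, `χ(σ) = 1` if `σt = t` and `−1` otherwise. Proof:
`ι m = Ψ(u)` with `u^{p^k} = q^a` (kernel `q^ℤ`), so `ζ = σu/u` has `ζ^{p^k} = σ(q^a)/q^a = 1`;
and `σ•ι m − χ(σ) ι m = χ(σ)(Ψ(σu) − Ψ(u)) = Ψ(ζ^{χ(σ)})`. This is GV's "`D ≅ ℚ_p/ℤ_p(φ)`" for the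
unramified character `φ = χ` (pp. 14–15), in the tree's `LocalDatum` language.
[cite: GreenbergVatsal2000, §2 pp. 14–15] [cite: SilvermanATAEC1994, Ch. V Thm. 3.1 (c),(d), Lemma 5.2 (c)] -/
theorem smul_sub_sign_smul_mem (σ : absoluteGaloisGroup (v.adicCompletion K))
    (m : W.geomPrimaryTorsion p) :
    absGaloisRestrict K (v.adicCompletion K) σ • m -
        (if Field.absoluteGaloisGroup.toAlgEquiv (v.adicCompletion K) σ t = t then (1 : ℤ)
          else -1) • m ∈ (tateDatum W p Ψ (sign_disj W Ψ t hΨσ)).plus := by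
  obtain ⟨u, hu⟩ := hsurj (pointsMap W (v.adicCompletion K) (m : W.geomPoints))
  obtain ⟨u', rfl⟩ : ∃ u' : (AlgebraicClosure (v.adicCompletion K))ˣ, Additive.ofMul u' = u :=
    ⟨Additive.toMul u, ofMul_toMul u⟩
  obtain ⟨k, hk⟩ := (AddCommGroup.mem_primaryComponent).1 m.2
  have h0 : Ψ (Additive.ofMul (u' ^ p ^ k)) = 0 := by
    rw [ofMul_pow, map_nsmul, hu, ← map_nsmul, hk, map_zero]
  obtain ⟨a, ha⟩ := hker _ h0
  set ζ : (AlgebraicClosure (v.adicCompletion K))ˣ :=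
    Units.map (Field.absoluteGaloisGroup.toAlgEquiv (v.adicCompletion K) σ :
      AlgebraicClosure (v.adicCompletion K) →* AlgebraicClosure (v.adicCompletion K)) u' * u'⁻¹
    with hζdef
  have hζfin : IsOfFinOrder ζ := by
    refine isOfFinOrder_iff_pow_eq_one.2 ⟨p ^ k, pow_pos hp.out.pos k, ?_⟩
    rw [hζdef, mul_pow, inv_pow, ← map_pow, mul_inv_eq_one]
    ext
    rw [Units.coe_map, MonoidHom.coe_coe, ha, map_zpow₀, AlgEquiv.commutes]
  -- `Ψ(σ u') - Ψ(u') = Ψ(ζ)`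
  have hΨζ : Ψ (Additive.ofMul ζ) = Ψ (Additive.ofMul (Units.map
      (Field.absoluteGaloisGroup.toAlgEquiv (v.adicCompletion K) σ :
        AlgebraicClosure (v.adicCompletion K) →* AlgebraicClosure (v.adicCompletion K)) u')) -
      Ψ (Additive.ofMul u') := by
    rw [hζdef, ofMul_mul, ofMul_inv, map_add, map_neg, sub_eq_add_neg]
  have hιsmul : pointsMap W (v.adicCompletion K)
      (((absGaloisRestrict K (v.adicCompletion K) σ • m : W.geomPrimaryTorsion p)) : W.geomPoints) =
      σ • Ψ (Additive.ofMul u') := by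
    rw [primaryComponent.coe_smul, GreenbergVatsalReductionDatum.pointsMap_absGaloisRestrict_smul, hu]
  rw [mem_tateDatum_plus_iff]
  by_cases hσt : Field.absoluteGaloisGroup.toAlgEquiv (v.adicCompletion K) σ t = t
  · refine ⟨ζ, hζfin, ?_⟩
    rw [if_pos hσt, one_zsmul, AddSubgroupClass.coe_sub, map_sub, hιsmul, hΨσ σ u', if_pos hσt,
      one_zsmul, hΨζ, hu]
  · refine ⟨ζ⁻¹, hζfin.inv, ?_⟩
    rw [if_neg hσt, neg_one_zsmul, sub_neg_eq_add, AddMemClass.coe_add, map_add, hιsmul,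
      hΨσ σ u', if_neg hσt, neg_one_zsmul, ofMul_inv, map_neg, hΨζ, hu, neg_sub,
      sub_eq_neg_add]

include hsurj hker in
/-- In `D = E[p^∞]/C`: **`res σ` acts on the class of `m` as the sign `χ(σ)`**.
[cite: GreenbergVatsal2000, §2 pp. 14–15] -/
theorem smul_grMk_eq_sign_smul (σ : absoluteGaloisGroup (v.adicCompletion K))
    (m : W.geomPrimaryTorsion p) :
    (⟨absGaloisRestrict K (v.adicCompletion K) σ, ⟨σ, rfl⟩⟩ : decomp (K := K) v) •
        (tateDatum W p Ψ (sign_disj W Ψ t hΨσ)).grMk m =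
      (if Field.absoluteGaloisGroup.toAlgEquiv (v.adicCompletion K) σ t = t then (1 : ℤ)
        else -1) • (tateDatum W p Ψ (sign_disj W Ψ t hΨσ)).grMk m := by
  rw [LocalDatum.smul_grMk, ← map_zsmul, grMk_eq_grMk_iff]
  exact smul_sub_sign_smul_mem W p Ψ t hΨσ hsurj hker σ m

include hsurj hker in
/-- If `σ` fixes `t`, `res σ` acts TRIVIALLY on `D`. [cite: GreenbergVatsal2000, §2 pp. 14–15] -/
theorem smul_gr_eq_of_apply_eq {σ : absoluteGaloisGroup (v.adicCompletion K)}
    (hσ : Field.absoluteGaloisGroup.toAlgEquiv (v.adicCompletion K) σ t = t)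
    (d : (tateDatum W p Ψ (sign_disj W Ψ t hΨσ)).Gr) :
    (⟨absGaloisRestrict K (v.adicCompletion K) σ, ⟨σ, rfl⟩⟩ : decomp (K := K) v) • d = d := by
  obtain ⟨m, rfl⟩ := (tateDatum W p Ψ (sign_disj W Ψ t hΨσ)).grMk_surjective d
  rw [smul_grMk_eq_sign_smul W p Ψ t hΨσ hsurj hker σ m, if_pos hσ, one_zsmul]

include hsurj hker in
/-- If `σ` moves `t` (`σt = −t`), `res σ` acts on `D` as `−1`. [cite: GreenbergVatsal2000, §2 pp. 14–15] -/
theorem smul_gr_eq_neg_of_apply_ne {σ : absoluteGaloisGroup (v.adicCompletion K)}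
    (hσ : Field.absoluteGaloisGroup.toAlgEquiv (v.adicCompletion K) σ t ≠ t)
    (d : (tateDatum W p Ψ (sign_disj W Ψ t hΨσ)).Gr) :
    (⟨absGaloisRestrict K (v.adicCompletion K) σ, ⟨σ, rfl⟩⟩ : decomp (K := K) v) • d = -d := by
  obtain ⟨m, rfl⟩ := (tateDatum W p Ψ (sign_disj W Ψ t hΨσ)).grMk_surjective d
  rw [smul_grMk_eq_sign_smul W p Ψ t hΨσ hsurj hker σ m, if_neg hσ, neg_one_zsmul]

include hsurj hker in
/-- Every element of `D_v` acts on `D` as `+1` or `−1` (GV: `D ≅ ℚ_p/ℤ_p(φ)`, `φ` of order `≤ 2`).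
[cite: GreenbergVatsal2000, §2 pp. 14–15] -/
theorem smul_gr_eq_or_eq_neg (δ : decomp (K := K) v)
    (d : (tateDatum W p Ψ (sign_disj W Ψ t hΨσ)).Gr) : δ • d = d ∨ δ • d = -d := by
  obtain ⟨σ, hσ⟩ := (mem_decomp_iff v (δ : absoluteGaloisGroup K)).1 δ.2
  have e : δ = ⟨absGaloisRestrict K (v.adicCompletion K) σ, ⟨σ, rfl⟩⟩ := Subtype.ext hσ.symm
  subst e
  by_cases h : Field.absoluteGaloisGroup.toAlgEquiv (v.adicCompletion K) σ t = t
  · exact Or.inl (smul_gr_eq_of_apply_eq W p Ψ t hΨσ hsurj hker h d)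
  · exact Or.inr (smul_gr_eq_neg_of_apply_ne W p Ψ t hΨσ hsurj hker h d)

/-! ## §3. Non-split: a Frobenius flipping `t` makes `Frob − 1 = −2` surjective on `D` (odd `p`) -/

include hsurj hker in
/-- **`res σ − 1` is SURJECTIVE on `D` when `σt ≠ t` and `p` is odd**: `res σ` acts as `−1`, and
`d = (res σ − 1)(−d')` for `2•d' = d` (`exists_two_nsmul_eq`). This is the hypothesis `hsurj` of
`GreenbergVatsalStrictCore.exists_eq_smul_sub_of_vanishing_on_inertia_of_surjective` for the Tate
datum at a NON-split place (`H¹(⟨Frob⟩, ℚ_p/ℤ_p(φ)) = 0`, `φ(Frob) = −1`, `p` odd) — GV p. 15: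
"the arguments … go through almost unchanged". [cite: GreenbergVatsal2000, §2 p. 15]
[cite: SerreLocalFields1979, Ch. XIII §1] -/
theorem exists_smul_sub_eq_of_apply_ne [W.IsElliptic] (hp2 : p ≠ 2)
    {σ : absoluteGaloisGroup (v.adicCompletion K)}
    (hσ : Field.absoluteGaloisGroup.toAlgEquiv (v.adicCompletion K) σ t ≠ t)
    (d : (tateDatum W p Ψ (sign_disj W Ψ t hΨσ)).Gr) :
    ∃ d' : (tateDatum W p Ψ (sign_disj W Ψ t hΨσ)).Gr,
      (⟨absGaloisRestrict K (v.adicCompletion K) σ, ⟨σ, rfl⟩⟩ : decomp (K := K) v) • d' - d' = d := by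
  obtain ⟨e, he⟩ := exists_two_nsmul_eq W p (tateDatum W p Ψ (sign_disj W Ψ t hΨσ)) hp2 d
  refine ⟨-e, ?_⟩
  rw [smul_neg, smul_gr_eq_neg_of_apply_ne W p Ψ t hΨσ hsurj hker hσ e, neg_neg, sub_neg_eq_add,
    ← two_nsmul, he]

end Sign

/-! ## §4. Split: for an untwisted (`Γ_{K_v}`-equivariant) parametrisation `D_v` acts trivially on `D` -/

section Split

variable [hp : Fact p.Prime]
  (Φ : Additive (AlgebraicClosure (v.adicCompletion K))ˣ →+ localPoints W (v.adicCompletion K))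
  (hΦσ : ∀ (σ : absoluteGaloisGroup (v.adicCompletion K))
      (u : (AlgebraicClosure (v.adicCompletion K))ˣ),
    σ • Φ (Additive.ofMul u) = Φ (Additive.ofMul (Units.map
      (Field.absoluteGaloisGroup.toAlgEquiv (v.adicCompletion K) σ :
        AlgebraicClosure (v.adicCompletion K) →* AlgebraicClosure (v.adicCompletion K)) u)))
  (hsurj : Function.Surjective Φ) {q : v.adicCompletion K}
  (hker : ∀ u : (AlgebraicClosure (v.adicCompletion K))ˣ, Φ (Additive.ofMul u) = 0 →
    ∃ a : ℤ, (u : AlgebraicClosure (v.adicCompletion K)) =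
      algebraMap (v.adicCompletion K) (AlgebraicClosure (v.adicCompletion K)) q ^ a)

include hΦσ in
/-- The untwisted equivariance is the twisted one with `t = 0` (`σ 0 = 0` always): sign `+1`.
[cite: SilvermanATAEC1994, Ch. V Thm. 3.1 (d) and Thm. 5.3 (b)] -/
theorem sign_of_equivariant : ∀ (σ : absoluteGaloisGroup (v.adicCompletion K))
      (u : (AlgebraicClosure (v.adicCompletion K))ˣ),
    σ • Φ (Additive.ofMul u) =
      (if Field.absoluteGaloisGroup.toAlgEquiv (v.adicCompletion K) σ (0 : AlgebraicClosure
          (v.adicCompletion K)) = 0 then (1 : ℤ) else -1) •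
      Φ (Additive.ofMul (Units.map
        (Field.absoluteGaloisGroup.toAlgEquiv (v.adicCompletion K) σ :
          AlgebraicClosure (v.adicCompletion K) →* AlgebraicClosure (v.adicCompletion K)) u)) := by
  intro σ u
  rw [if_pos (map_zero _), one_zsmul, hΦσ σ u]

include hsurj hker in
/-- **At a SPLIT place the whole decomposition group acts trivially on `D = E[p^∞]/C`**:
`res σ • m − m ∈ C` for every `σ ∈ Γ_{K_v}` (not only inertia, cf. gen 9 `tateDatum_htriv`) — GV
p. 14: "`D ≅ ℚ_p/ℤ_p`" with trivial action; hence `H¹(G_𝔭/I_𝔭, D) = D ≠ 0`, the source of the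
trivial zero `e_p = 1` (p. 15). [cite: GreenbergVatsal2000, §2 pp. 14–15]
[cite: SilvermanATAEC1994, Ch. V Thm. 3.1 (c),(d) and Thm. 5.3 (a),(b)] -/
theorem smul_sub_mem_of_equivariant (σ : absoluteGaloisGroup (v.adicCompletion K))
    (m : W.geomPrimaryTorsion p) :
    absGaloisRestrict K (v.adicCompletion K) σ • m - m ∈
      (tateDatum W p Φ (sign_disj W Φ 0 (sign_of_equivariant W Φ hΦσ))).plus := by
  have h := smul_sub_sign_smul_mem W p Φ 0 (sign_of_equivariant W Φ hΦσ) hsurj hker σ m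
  rwa [if_pos (map_zero _), one_zsmul] at h

include hsurj hker in
/-- At a split place every `δ ∈ D_v` fixes every `d ∈ D`. [cite: GreenbergVatsal2000, §2 pp. 14–15] -/
theorem smul_gr_eq_of_equivariant (δ : decomp (K := K) v)
    (d : (tateDatum W p Φ (sign_disj W Φ 0 (sign_of_equivariant W Φ hΦσ))).Gr) :
    δ • d = d := by
  obtain ⟨σ, hσ⟩ := (mem_decomp_iff v (δ : absoluteGaloisGroup K)).1 δ.2
  have e : δ = ⟨absGaloisRestrict K (v.adicCompletion K) σ, ⟨σ, rfl⟩⟩ := Subtype.ext hσ.symm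
  subst e
  exact smul_gr_eq_of_apply_eq W p Φ 0 (sign_of_equivariant W Φ hΦσ) hsurj hker (map_zero _) d

end Split

end Summit.BirchSwinnertonDyer.Rank1Residual.X2.GreenbergVatsalTateDatumSign

end
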